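import Literature.NumberTheory.Irrationality.LaiYu2020.AnalysisLemmaTerms
import Mathlib.Analysis.SpecialFunctions.Log.Deriv
import Mathlib.Analysis.SpecialFunctions.Pow.Real
import Mathlib.Topology.Order.IntermediateValue
import HarnessLib

/-!
# Lai–Yu 2020, Lemma 4.1 — part 2: the functions `f`, `g`, `h`, Proposition 4.2 (1) (the root `x₀`),
# and the profile `Λ = log h`

Topic `Literature/NumberTheory/Irrationality/LaiYu2020`, namespace
`Literature.NumberTheory.Irrationality.LaiYu2020` (helpers in `Lemma41`). Source: L. Lai, P. Yu, *A note on the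
number of irrational odd zeta values*, Compositio Math. **156** (2020) 1699–1717 = arXiv:1911.08458 [LaiYu2020],
§4 Lemma 4.1 and Proposition 4.2 (1) with its proof (held: `paper:arxiv-1911.08458`, arXiv text p. 8, read on the
page). Second of the files PROVING Lemma 4.1; everything here is proved, no named facts.

## The source, verbatim (the steps formalised here)
"**Lemma 4.1** (analysis lemma). We have `lim_{n→+∞} (r_{n,1})^{1/n} = g(x₀)`, where
`g(X) = A₁(B)A₂(B) den(r)^{(2r+1)|𝓕_B|} (X+2r+1)^{(2r+1)|𝓕_B|} ((X+r)^r/(X+r+1)^{r+1})^{s+1}`, and `x₀` is the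
unique positive real solution of the equation `f(X) = ((X+2r+1)/X)^{|𝓕_B|} ((X+r)/(X+r+1))^{s+1} = 1`. …
**Proposition 4.2.** (1) There exists a unique `x₀ ∈ (0,+∞)` such that `f(x₀) = 1`, `f(x) > 1` on `(0,x₀)` and
`f(x) < 1` on `x ∈ (x₀,+∞)`. Moreover, `x₀ < r(r+1)|𝓕_B|/(s+1 − (2r+1)|𝓕_B|)`. … *Proof.* For the first
proposition, by calculating `f'(x)/f(x)`, we find that `f'(x) = 0` has a unique positive solution `x₁` which
satisfies `(s+1−(2r+1)|𝓕_B|)x₁² + (2r+1)(s+1−(2r+1)|𝓕_B|)x₁ − r(r+1)(2r+1)|𝓕_B| = 0` (4.1), and `f` is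
decreasing on `(0,x₁)`, increasing on `(x₁,+∞)`. Since `f(0⁺) = +∞` and `f(+∞) = 1`, there exists a unique `x₀`
satisfying all the requirements. The last (very weak) bound for `x₀` comes from `x₀ < x₁` and (4.1)." … (proof of
Lemma 4.1) "the function `h(x)` is defined for `x > 0` as `h(x) = f(x)^x g(x)`, a direct computation shows that
`h'(x)/h(x) = log f(x)`. Hence, `h(x)` achieves its maximum only at `x = x₀` with maximal value `h(x₀) = g(x₀)`."

## What is proved here
* Part A (structure of `f`, Prop. 4.2 (1)): `fLY`, `phiLY = log f`, its derivative `q(x)/(x(x+2r+1)(x+r)(x+r+1))`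
  with `q(x) = a x² + (2r+1) a x − (2r+1) r (r+1) N` (`a = s+1−(2r+1)N`, the printed (4.1)), the critical
  point `x₁` (`exists_critical`), `f → 1` at `+∞`, an explicit small point with `f > 1` (the printed
  `f(0⁺) = +∞`), and **`exists_root`**: `x₀ > 0` with `f(x₀) = 1`, `f > 1` on `(0,x₀)`, `f < 1` on `(x₀,∞)`
  and the printed bound `x₀ < r(r+1)N/a`; `root_unique`.
* Part B (the profile): `gLY` as printed (real powers) with `log_gLY`, **`Lam_eq : Λ(x) = log g(x) + x log f(x)`**
  (so `Λ = log h`, `Λ(x₀) = log g(x₀)`: `Lam_root`), `hasDerivAt_Lam : Λ' = log f` (the printed `h'/h = log f`),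
  `Λ` strictly increasing on `[0,x₀]`, strictly decreasing on `[x₀,∞)` ("`h` achieves its maximum only at
  `x = x₀`"), `Lam_le_root`, `Lam_gap`.
Parameters: `r = u/v` (`u, v ≥ 1`), `N = |𝓕_B| ≥ 1`, and `(2u+v)N < (s+1)v` (i.e. `a > 0`).

## Not here
Prop. 4.2 (2) (the `s → ∞` asymptotics of `g(x₀)`), the limits of Lemma 4.1, the ratio: sibling files. Cell
zeta5-irr (rung F-Z1): nothing here bears on `ζ(5)`.
-/

noncomputable section

open Finset Filter Set

open scoped Nat Topology

namespace Literature.NumberTheory.Irrationality.LaiYu2020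

open Literature.NumberTheory.Irrationality.FischlerSprangZudilin2019.Lemma3 (F hasDerivAt_F continuous_F)

namespace Lemma41

/-! ### Part A: the function `f` and its logarithm (Proposition 4.2 (1)) -/

/-- **`f(X) = ((X+2r+1)/X)^{|𝓕_B|} ((X+r)/(X+r+1))^{s+1}`** for `r = u/v` and `|𝓕_B| = N`.
[cite: LaiYu2020, Lemma 4.1 (definition of f)] -/
def fLY (u v s N : ℕ) (x : ℝ) : ℝ :=
  ((x + (2 * (u : ℝ) + v) / v) / x) ^ N * ((x + (u : ℝ) / v) / (x + (u : ℝ) / v + 1)) ^ (s + 1)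

/-- `φ(x) = log f(x) = N(log(x+2r+1) − log x) + (s+1)(log(x+r) − log(x+r+1))`.
[cite: LaiYu2020, proof of Prop. 4.2 (1) ("by calculating f'(x)/f(x)")] -/
def phiLY (u v s N : ℕ) (x : ℝ) : ℝ :=
  (N : ℝ) * (Real.log (x + (2 * (u : ℝ) + v) / v) - Real.log x) +
    ((s : ℝ) + 1) * (Real.log (x + (u : ℝ) / v) - Real.log (x + (u : ℝ) / v + 1))

/-- `2r+1 = (2u+v)/v > 0` for `v ≥ 1`. [cite: LaiYu2020, §2 ("the Ball–Rivoal length parameter r")] -/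
theorem rho_pos {u v : ℕ} (hv : 1 ≤ v) : 0 < (2 * (u : ℝ) + v) / v := by
  have : (0 : ℝ) < v := by exact_mod_cast hv
  positivity

/-- `r = u/v > 0` for `u, v ≥ 1`. [cite: LaiYu2020, §2 ("r … a positive rational number")] -/
theorem r_pos {u v : ℕ} (hu : 1 ≤ u) (hv : 1 ≤ v) : 0 < (u : ℝ) / v := by
  have : (0 : ℝ) < v := by exact_mod_cast hv
  have : (0 : ℝ) < u := by exact_mod_cast hu
  positivity

/-- `f(x) > 0` for `x > 0`. [cite: LaiYu2020, Lemma 4.1 (definition of f)] -/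
theorem fLY_pos {u v : ℕ} (hv : 1 ≤ v) (s N : ℕ) {x : ℝ} (hx : 0 < x) : 0 < fLY u v s N x := by
  have := rho_pos (u := u) hv
  have : (0 : ℝ) ≤ (u : ℝ) / v := by positivity
  unfold fLY; positivity

/-- `log f = φ` on `x > 0`. [cite: LaiYu2020, proof of Prop. 4.2 (1) (f'/f)] -/
theorem log_fLY {u v : ℕ} (hv : 1 ≤ v) (s N : ℕ) {x : ℝ} (hx : 0 < x) :
    Real.log (fLY u v s N x) = phiLY u v s N x := by
  have hρ := rho_pos (u := u) hv
  have hr : (0 : ℝ) ≤ (u : ℝ) / v := by positivity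
  unfold fLY phiLY
  rw [Real.log_mul (by positivity) (by positivity), Real.log_pow, Real.log_pow,
    Real.log_div (by positivity) hx.ne', Real.log_div (by positivity) (by positivity)]
  push_cast
  ring

/-- `f = exp ∘ φ` on `x > 0`. [cite: LaiYu2020, proof of Prop. 4.2 (1) (f'/f)] -/
theorem fLY_eq_exp_phi {u v : ℕ} (hv : 1 ≤ v) (s N : ℕ) {x : ℝ} (hx : 0 < x) :
    fLY u v s N x = Real.exp (phiLY u v s N x) := by
  rw [← log_fLY hv s N hx, Real.exp_log (fLY_pos hv s N hx)]

/-- **The numerator `q(x) = a x² + (2r+1) a x − (2r+1) r (r+1) N` of `f'/f`**, `a = s+1−(2r+1)N` — the left side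
of the printed (4.1). [cite: LaiYu2020, proof of Prop. 4.2 (1), eq. (4.1)] -/
def qLY (u v s N : ℕ) (x : ℝ) : ℝ :=
  ((s : ℝ) + 1 - (2 * (u : ℝ) + v) / v * N) * x ^ 2 +
    (2 * (u : ℝ) + v) / v * ((s : ℝ) + 1 - (2 * (u : ℝ) + v) / v * N) * x -
    (2 * (u : ℝ) + v) / v * ((u : ℝ) / v) * ((u : ℝ) / v + 1) * N

/-- **`φ'(x) = q(x)/(x(x+2r+1)(x+r)(x+r+1))`** for `x > 0`. [cite: LaiYu2020, proof of Prop. 4.2 (1) (f'/f)] -/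
theorem hasDerivAt_phi {u v : ℕ} (hv : 1 ≤ v) (s N : ℕ) {x : ℝ} (hx : 0 < x) :
    HasDerivAt (phiLY u v s N) (qLY u v s N x /
      (x * (x + (2 * (u : ℝ) + v) / v) * (x + (u : ℝ) / v) * (x + (u : ℝ) / v + 1))) x := by
  have hρ := rho_pos (u := u) hv
  have hr : (0 : ℝ) ≤ (u : ℝ) / v := by positivity
  have h3 : HasDerivAt (fun y : ℝ => Real.log (y + (2 * (u : ℝ) + v) / v)) (1 / (x + (2 * (u : ℝ) + v) / v)) x :=
    ((hasDerivAt_id x).add_const _).log (by simp; linarith)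
  have h0 : HasDerivAt (fun y : ℝ => Real.log y) (1 / x) x := by
    simpa using ((hasDerivAt_id x).log (by simp; exact hx.ne'))
  have h1 : HasDerivAt (fun y : ℝ => Real.log (y + (u : ℝ) / v)) (1 / (x + (u : ℝ) / v)) x :=
    ((hasDerivAt_id x).add_const _).log (by simp; linarith)
  have h2 : HasDerivAt (fun y : ℝ => Real.log (y + (u : ℝ) / v + 1)) (1 / (x + (u : ℝ) / v + 1)) x := by
    have := ((hasDerivAt_id x).add_const ((u : ℝ) / v + 1)).log (by simp; linarith)
    simpa [add_assoc] using this
  have h := ((h3.sub h0).const_mul (N : ℝ)).add ((h1.sub h2).const_mul ((s : ℝ) + 1))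
  refine (show HasDerivAt (phiLY u v s N) _ x from h).congr_deriv ?_
  unfold qLY
  field_simp
  ring

/-- `φ` is continuous at every `x > 0`. [cite: LaiYu2020, proof of Prop. 4.2 (1) (f'/f)] -/
theorem continuousOn_phi {u v : ℕ} (hv : 1 ≤ v) (s N : ℕ) : ContinuousOn (phiLY u v s N) (Ioi 0) :=
  fun _ hx => (hasDerivAt_phi hv s N hx).continuousAt.continuousWithinAt

/-- `q` is strictly increasing on `[0, ∞)` when `a = s+1−(2r+1)N > 0`, i.e. `(2u+v)N < (s+1)v`.
[cite: LaiYu2020, proof of Prop. 4.2 (1) ("f'(x) = 0 has a unique positive solution x₁")] -/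
theorem qLY_lt_qLY {u v s N : ℕ} (hv : 1 ≤ v) (hNs : (2 * u + v) * N < (s + 1) * v) {x y : ℝ}
    (hx : 0 ≤ x) (hxy : x < y) : qLY u v s N x < qLY u v s N y := by
  have hv0 : (0 : ℝ) < v := by exact_mod_cast hv
  have hρ := rho_pos (u := u) hv
  have ha : 0 < (s : ℝ) + 1 - (2 * (u : ℝ) + v) / v * N := by
    have h : ((2 * u + v) * N : ℝ) < (s + 1) * v := by exact_mod_cast hNs
    rw [div_mul_eq_mul_div, sub_pos, div_lt_iff₀ hv0]
    linarith
  unfold qLY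
  have h1 : x ^ 2 < y ^ 2 := by nlinarith
  have h2 := mul_lt_mul_of_pos_left h1 ha
  have h3 := mul_lt_mul_of_pos_left hxy (mul_pos hρ ha)
  linarith

/-- **The critical point `x₁`** (`u, v ≥ 1`, `N ≥ 1`, `(2u+v)N < (s+1)v`): the unique positive zero of `q`, with
`q < 0` before and `q > 0` after it, and `x₁ < r(r+1)N/a`.
[cite: LaiYu2020, proof of Prop. 4.2 (1), eq. (4.1)] -/
theorem exists_critical {u v s N : ℕ} (hu : 1 ≤ u) (hv : 1 ≤ v) (hN : 1 ≤ N) (hNs : (2 * u + v) * N < (s + 1) * v) :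
    ∃ x₁ : ℝ, 0 < x₁ ∧ qLY u v s N x₁ = 0 ∧ (∀ x, 0 ≤ x → x < x₁ → qLY u v s N x < 0) ∧
      (∀ x, x₁ < x → 0 < qLY u v s N x) ∧
      x₁ < ((u : ℝ) / v) * ((u : ℝ) / v + 1) * N / ((s : ℝ) + 1 - (2 * (u : ℝ) + v) / v * N) := by
  have hv0 : (0 : ℝ) < v := by exact_mod_cast hv
  have hu0 : (0 : ℝ) < u := by exact_mod_cast hu
  have hN1 : (1 : ℝ) ≤ N := by exact_mod_cast hN
  have hρ := rho_pos (u := u) hv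
  have hr := r_pos hu hv
  set ρ : ℝ := (2 * (u : ℝ) + v) / v with hρdef
  set r : ℝ := (u : ℝ) / v with hrdef
  set a : ℝ := (s : ℝ) + 1 - ρ * N with hadef
  have hav : 1 ≤ a * v := by
    have h : ((2 * u + v) * N : ℝ) + 1 ≤ (s + 1) * v := by exact_mod_cast hNs
    have e : a * v = ((s : ℝ) + 1) * v - (2 * (u : ℝ) + v) * N := by
      rw [hadef, hρdef]
      field_simp
    linarith
  have ha : 0 < a := by
    by_contra h
    push Not at h
    nlinarith
  set c₀ : ℝ := ρ * r * (r + 1) * N with hc₀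
  have hc₀pos : 0 < c₀ := by positivity
  have hq : ∀ x, qLY u v s N x = a * x ^ 2 + ρ * a * x - c₀ := fun x => by
    simp only [qLY, hadef, hρdef, hrdef, hc₀]
  have hq0 : qLY u v s N 0 < 0 := by rw [hq]; nlinarith
  set X : ℝ := v * c₀ + 1 with hX
  have hX1 : 1 ≤ X := by rw [hX]; nlinarith
  have hqX : 0 < qLY u v s N X := by
    rw [hq]
    have h1 : a * X ≥ c₀ + a := by
      rw [hX]
      nlinarith
    have h2 : a * X ^ 2 ≥ a * X := by nlinarith
    nlinarith
  have hcont : ContinuousOn (qLY u v s N) (Icc 0 X) := by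
    unfold qLY; fun_prop
  obtain ⟨x₁, hx₁, hqx₁⟩ := intermediate_value_Ioo (by linarith) hcont ⟨hq0, hqX⟩
  refine ⟨x₁, hx₁.1, hqx₁, fun x hx hlt => ?_, fun x hlt => ?_, ?_⟩
  · have := qLY_lt_qLY hv hNs hx hlt
    linarith
  · have := qLY_lt_qLY hv hNs hx₁.1.le hlt
    linarith
  · -- `a x₁ (x₁ + ρ) = c₀`, so `x₁ = c₀/(a(x₁+ρ)) < c₀/(a ρ) = r(r+1)N/a`
    rw [hq] at hqx₁
    have hkey : a * x₁ * (x₁ + ρ) = ρ * (r * (r + 1) * N) := by rw [hc₀] at hqx₁; linarith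
    have hlt : a * x₁ * ρ < a * x₁ * (x₁ + ρ) := by
      have := mul_pos ha hx₁.1
      nlinarith
    rw [lt_div_iff₀ ha]
    have : x₁ * a * ρ < r * (r + 1) * N * ρ := by nlinarith
    have := lt_of_mul_lt_mul_right this hρ.le
    linarith

/-- **`f(x) → 1` as `x → +∞`** ("`f(+∞) = 1`"). [cite: LaiYu2020, proof of Prop. 4.2 (1)] -/
theorem tendsto_fLY_atTop (u v s N : ℕ) : Tendsto (fLY u v s N) atTop (𝓝 1) := by
  have h1 : Tendsto (fun x : ℝ => (x + (2 * (u : ℝ) + v) / v) / x) atTop (𝓝 1) := by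
    have h : Tendsto (fun x : ℝ => 1 + ((2 * (u : ℝ) + v) / v) / x) atTop (𝓝 (1 + 0)) :=
      tendsto_const_nhds.add (tendsto_const_nhds.div_atTop tendsto_id)
    rw [add_zero] at h
    refine h.congr' ?_
    filter_upwards [eventually_gt_atTop 0] with x hx
    field_simp
  have h2 : Tendsto (fun x : ℝ => (x + (u : ℝ) / v) / (x + (u : ℝ) / v + 1)) atTop (𝓝 1) := by
    have h : Tendsto (fun x : ℝ => 1 - 1 / (x + (u : ℝ) / v + 1)) atTop (𝓝 (1 - 0)) :=
      tendsto_const_nhds.sub (tendsto_const_nhds.div_atTop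
        (tendsto_atTop_add_const_right _ _ (tendsto_atTop_add_const_right _ _ tendsto_id)))
    rw [sub_zero] at h
    refine h.congr' ?_
    filter_upwards [eventually_gt_atTop 0] with x hx
    have : (0 : ℝ) ≤ (u : ℝ) / v := by positivity
    field_simp
    ring
  have h := (h1.pow N).mul (h2.pow (s + 1))
  rw [one_pow, one_pow, one_mul] at h
  exact h

/-- An explicit point of `(0, x₀)`: `f(1/(2(v+1)^{s+1})) > 1` (the printed "`f(0⁺) = +∞`"; uses `N ≥ 1`,
`u ≥ 1`, so `(x+2r+1)/x ≥ 1/x` and `(x+r)/(x+r+1) ≥ r/(r+1) ≥ 1/(v+1)`).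
[cite: LaiYu2020, proof of Prop. 4.2 (1) ("f(0⁺) = +∞")] -/
theorem one_lt_fLY_small {u v s N : ℕ} (hu : 1 ≤ u) (hv : 1 ≤ v) (hN : 1 ≤ N) :
    1 < fLY u v s N (1 / (2 * ((v : ℝ) + 1) ^ (s + 1))) := by
  have hv0 : (0 : ℝ) < v := by exact_mod_cast hv
  have hv1 : (1 : ℝ) ≤ v := by exact_mod_cast hv
  have hu1 : (1 : ℝ) ≤ u := by exact_mod_cast hu
  have hρ := rho_pos (u := u) hv
  have hr := r_pos hu hv
  set x : ℝ := 1 / (2 * ((v : ℝ) + 1) ^ (s + 1)) with hx_def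
  have hP : (0 : ℝ) < ((v : ℝ) + 1) ^ (s + 1) := by positivity
  have hx : 0 < x := by positivity
  -- first factor ≥ 2 (v+1)^{s+1}
  have hA1 : (1 : ℝ) ≤ (x + (2 * (u : ℝ) + v) / v) / x := by
    rw [le_div_iff₀ hx]; linarith
  have hA : 2 * ((v : ℝ) + 1) ^ (s + 1) ≤ ((x + (2 * (u : ℝ) + v) / v) / x) ^ N := by
    calc 2 * ((v : ℝ) + 1) ^ (s + 1) = 1 / x := by rw [hx_def, one_div_one_div]
      _ ≤ (x + (2 * (u : ℝ) + v) / v) / x := by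
          rw [div_le_div_iff₀ hx hx]
          have hρ1 : (1 : ℝ) ≤ (2 * (u : ℝ) + v) / v := by rw [le_div_iff₀ hv0]; linarith
          nlinarith
      _ ≤ ((x + (2 * (u : ℝ) + v) / v) / x) ^ N := le_self_pow₀ hA1 (by omega)
  -- second factor ≥ (1/(v+1))^{s+1}
  have hB : 1 / ((v : ℝ) + 1) ≤ (x + (u : ℝ) / v) / (x + (u : ℝ) / v + 1) := by
    rw [div_le_div_iff₀ (by positivity) (by positivity)]
    have hr1 : 1 / (v : ℝ) ≤ (u : ℝ) / v := div_le_div_of_nonneg_right hu1 hv0.le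
    have : (v : ℝ) * (1 / v) = 1 := by field_simp
    nlinarith
  have hBs : (1 / ((v : ℝ) + 1)) ^ (s + 1) ≤ ((x + (u : ℝ) / v) / (x + (u : ℝ) / v + 1)) ^ (s + 1) :=
    pow_le_pow_left₀ (by positivity) hB _
  have h2 : (2 : ℝ) = 2 * ((v : ℝ) + 1) ^ (s + 1) * (1 / ((v : ℝ) + 1)) ^ (s + 1) := by
    rw [one_div_pow]; field_simp
  unfold fLY
  calc (1 : ℝ) < 2 := by norm_num
    _ = 2 * ((v : ℝ) + 1) ^ (s + 1) * (1 / ((v : ℝ) + 1)) ^ (s + 1) := h2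
    _ ≤ ((x + (2 * (u : ℝ) + v) / v) / x) ^ N * ((x + (u : ℝ) / v) / (x + (u : ℝ) / v + 1)) ^ (s + 1) :=
        mul_le_mul hA hBs (by positivity) (by positivity)

/-- **Proposition 4.2 (1) of Lai–Yu 2020** (PROVED): for `u, v ≥ 1`, `N ≥ 1` and `(2u+v)N < (s+1)v` there is
`x₀ > 0` with `f(x₀) = 1`, `f > 1` on `(0,x₀)`, `f < 1` on `(x₀,∞)`, and `x₀ < r(r+1)N/(s+1−(2r+1)N)`.
[cite: LaiYu2020, Prop. 4.2 (1)] -/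
theorem exists_root {u v s N : ℕ} (hu : 1 ≤ u) (hv : 1 ≤ v) (hN : 1 ≤ N) (hNs : (2 * u + v) * N < (s + 1) * v) :
    ∃ x₀ : ℝ, 0 < x₀ ∧ fLY u v s N x₀ = 1 ∧ (∀ x, 0 < x → x < x₀ → 1 < fLY u v s N x) ∧
      (∀ x, x₀ < x → fLY u v s N x < 1) ∧
      x₀ < ((u : ℝ) / v) * ((u : ℝ) / v + 1) * N / ((s : ℝ) + 1 - (2 * (u : ℝ) + v) / v * N) := by
  obtain ⟨x₁, hx₁, -, hneg, hpos, hx₁lt⟩ := exists_critical hu hv hN hNs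
  have hρ := rho_pos (u := u) hv
  have hr := r_pos hu hv
  -- φ is strictly decreasing on (0, x₁] and strictly increasing on [x₁, ∞)
  have hderiv : ∀ x, 0 < x → deriv (phiLY u v s N) x = qLY u v s N x /
      (x * (x + (2 * (u : ℝ) + v) / v) * (x + (u : ℝ) / v) * (x + (u : ℝ) / v + 1)) :=
    fun x hx => (hasDerivAt_phi hv s N hx).deriv
  have hanti : StrictAntiOn (phiLY u v s N) (Ioc 0 x₁) := by
    refine strictAntiOn_of_deriv_neg (convex_Ioc 0 x₁)
      ((continuousOn_phi hv s N).mono fun x hx => hx.1) fun x hx => ?_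
    rw [interior_Ioc] at hx
    rw [hderiv x hx.1]
    exact div_neg_of_neg_of_pos (hneg x hx.1.le hx.2) (by have := hx.1; positivity)
  have hmono : StrictMonoOn (phiLY u v s N) (Ici x₁) := by
    refine strictMonoOn_of_deriv_pos (convex_Ici x₁)
      ((continuousOn_phi hv s N).mono fun x hx => hx₁.trans_le hx) fun x hx => ?_
    rw [interior_Ici] at hx
    rw [hderiv x (hx₁.trans hx)]
    exact div_pos (hpos x hx) (by have := hx₁.trans hx; positivity)
  -- φ < 0 on [x₁, ∞), from f → 1
  have hphi_neg : ∀ x, x₁ ≤ x → phiLY u v s N x < 0 := by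
    intro x hx
    by_contra hcon
    push Not at hcon
    have hc : 0 < phiLY u v s N (x + 1) := lt_of_le_of_lt hcon (hmono hx (by simp; linarith) (by linarith))
    have hev : ∀ᶠ y in atTop, fLY u v s N y < Real.exp (phiLY u v s N (x + 1)) :=
      (tendsto_fLY_atTop u v s N).eventually (eventually_lt_nhds (Real.one_lt_exp_iff.2 hc))
    obtain ⟨y, hy1, hy2⟩ := (hev.and (eventually_ge_atTop (x + 1))).exists
    have hy0 : 0 < y := by linarith [hx₁]
    have hle : phiLY u v s N (x + 1) ≤ phiLY u v s N y :=
      hmono.monotoneOn (by simp; linarith) (by simp; linarith) hy2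
    rw [fLY_eq_exp_phi hv s N hy0, Real.exp_lt_exp] at hy1
    linarith
  -- the explicit point where f > 1 lies in (0, x₁)
  set xs : ℝ := 1 / (2 * ((v : ℝ) + 1) ^ (s + 1)) with hxs
  have hxs0 : 0 < xs := by positivity
  have hphis : 0 < phiLY u v s N xs := by
    rw [← log_fLY hv s N hxs0]
    exact Real.log_pos (one_lt_fLY_small hu hv hN)
  have hxs1 : xs < x₁ := by
    by_contra hcon
    push Not at hcon
    linarith [hphi_neg xs hcon]
  -- IVT on [xs, x₁]
  have hcont : ContinuousOn (phiLY u v s N) (Icc xs x₁) :=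
    (continuousOn_phi hv s N).mono fun x hx => hxs0.trans_le hx.1
  obtain ⟨x₀, hx₀, hroot⟩ := intermediate_value_Ioo' hxs1.le hcont ⟨hphi_neg x₁ le_rfl, hphis⟩
  have hx₀0 : 0 < x₀ := hxs0.trans hx₀.1
  refine ⟨x₀, hx₀0, ?_, fun x hx hlt => ?_, fun x hlt => ?_, hx₀.2.trans hx₁lt⟩
  · rw [fLY_eq_exp_phi hv s N hx₀0, hroot, Real.exp_zero]
  · rw [fLY_eq_exp_phi hv s N hx, ← Real.exp_zero, Real.exp_lt_exp, ← hroot]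
    exact hanti ⟨hx, (hlt.trans hx₀.2).le⟩ ⟨hx₀0, hx₀.2.le⟩ hlt
  · have hx : 0 < x := hx₀0.trans hlt
    rw [fLY_eq_exp_phi hv s N hx, ← Real.exp_zero, Real.exp_lt_exp]
    rcases le_or_gt x x₁ with h | h
    · rw [← hroot]
      exact hanti ⟨hx₀0, hx₀.2.le⟩ ⟨hx, h⟩ hlt
    · exact hphi_neg x h.le

/-- Uniqueness of the positive solution of `f(x) = 1` from the sign structure ("there exists a unique `x₀`").
[cite: LaiYu2020, Prop. 4.2 (1)] -/
theorem root_unique {u v s N : ℕ} {x₀ : ℝ} (hlt : ∀ x, 0 < x → x < x₀ → 1 < fLY u v s N x)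
    (hgt : ∀ x, x₀ < x → fLY u v s N x < 1) {x : ℝ} (hx : 0 < x) (h : fLY u v s N x = 1) : x = x₀ := by
  rcases lt_trichotomy x x₀ with h1 | h1 | h1
  · exact absurd h (hlt x hx h1).ne'
  · exact h1
  · exact absurd h (hgt x h1).ne

/-! ### Part B: `g`, and the profile `Λ = log h`, `h = f^x g` -/

/-- **`g(X) = A₁(B) A₂(B) den(r)^{(2r+1)|𝓕_B|} (X+2r+1)^{(2r+1)|𝓕_B|} ((X+r)^r/(X+r+1)^{r+1})^{s+1}`** for
`r = u/v` (`den r` rendered as `v`; real powers). [cite: LaiYu2020, Lemma 4.1 (definition of g)] -/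
def gLY (u v s : ℕ) (B : ℝ) (x : ℝ) : ℝ :=
  A₁ ((u : ℚ) / v) B * A₂ ((u : ℚ) / v) B *
    (v : ℝ) ^ ((2 * (u : ℝ) + v) / v * ((zeroSet_finite B).toFinset.card : ℝ)) *
    (x + (2 * (u : ℝ) + v) / v) ^ ((2 * (u : ℝ) + v) / v * ((zeroSet_finite B).toFinset.card : ℝ)) *
    ((x + (u : ℝ) / v) ^ ((u : ℝ) / v) / (x + (u : ℝ) / v + 1) ^ ((u : ℝ) / v + 1)) ^ (s + 1)

/-- **`log g(x)`** (`x ≥ 0`, `u, v ≥ 1`):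
`log A₁ + log A₂ + (2r+1)N log v + (2r+1)N log(x+2r+1) + (s+1)(r log(x+r) − (r+1) log(x+r+1))`.
[cite: LaiYu2020, Lemma 4.1 (definition of g)] -/
theorem log_gLY {u v : ℕ} (hu : 1 ≤ u) (hv : 1 ≤ v) (s : ℕ) (B : ℝ) {x : ℝ} (hx : 0 ≤ x) :
    Real.log (gLY u v s B x) = Real.log (A₁ ((u : ℚ) / v) B) + Real.log (A₂ ((u : ℚ) / v) B) +
      (2 * (u : ℝ) + v) / v * ((zeroSet_finite B).toFinset.card : ℝ) * Real.log v +
      (2 * (u : ℝ) + v) / v * ((zeroSet_finite B).toFinset.card : ℝ) * Real.log (x + (2 * (u : ℝ) + v) / v) +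
      ((s : ℝ) + 1) * ((u : ℝ) / v * Real.log (x + (u : ℝ) / v) -
        ((u : ℝ) / v + 1) * Real.log (x + (u : ℝ) / v + 1)) := by
  have hv0 : (0 : ℝ) < v := by exact_mod_cast hv
  have hρ := rho_pos (u := u) hv
  have hr := r_pos hu hv
  have hA1 := A₁_pos ((u : ℚ) / v) B
  have hA2 := A₂_pos ((u : ℚ) / v) B
  have h1 : 0 < (v : ℝ) ^ ((2 * (u : ℝ) + v) / v * ((zeroSet_finite B).toFinset.card : ℝ)) :=
    Real.rpow_pos_of_pos hv0 _
  have h2 : 0 < (x + (2 * (u : ℝ) + v) / v) ^ ((2 * (u : ℝ) + v) / v * ((zeroSet_finite B).toFinset.card : ℝ)) :=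
    Real.rpow_pos_of_pos (by linarith) _
  have h3 : 0 < (x + (u : ℝ) / v) ^ ((u : ℝ) / v) := Real.rpow_pos_of_pos (by linarith) _
  have h4 : 0 < (x + (u : ℝ) / v + 1) ^ ((u : ℝ) / v + 1) := Real.rpow_pos_of_pos (by linarith) _
  unfold gLY
  rw [Real.log_mul (by positivity) (by positivity), Real.log_mul (by positivity) h2.ne',
    Real.log_mul (by positivity) h1.ne', Real.log_mul hA1.ne' hA2.ne', Real.log_pow,
    Real.log_div h3.ne' h4.ne', Real.log_rpow hv0, Real.log_rpow (by linarith), Real.log_rpow (by linarith),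
    Real.log_rpow (by linarith)]
  push_cast
  ring

/-- `g(x) > 0` for `x ≥ 0`. [cite: LaiYu2020, Lemma 4.1 (definition of g)] -/
theorem gLY_pos {u v : ℕ} (hu : 1 ≤ u) (hv : 1 ≤ v) (s : ℕ) (B : ℝ) {x : ℝ} (hx : 0 ≤ x) :
    0 < gLY u v s B x := by
  have hv0 : (0 : ℝ) < v := by exact_mod_cast hv
  have hρ := rho_pos (u := u) hv
  have hr := r_pos hu hv
  have hA1 := A₁_pos ((u : ℚ) / v) B
  have hA2 := A₂_pos ((u : ℚ) / v) B
  have h1 : 0 < (v : ℝ) ^ ((2 * (u : ℝ) + v) / v * ((zeroSet_finite B).toFinset.card : ℝ)) :=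
    Real.rpow_pos_of_pos hv0 _
  have h2 : 0 < (x + (2 * (u : ℝ) + v) / v) ^ ((2 * (u : ℝ) + v) / v * ((zeroSet_finite B).toFinset.card : ℝ)) :=
    Real.rpow_pos_of_pos (by linarith) _
  have h3 : 0 < (x + (u : ℝ) / v) ^ ((u : ℝ) / v) := Real.rpow_pos_of_pos (by linarith) _
  have h4 : 0 < (x + (u : ℝ) / v + 1) ^ ((u : ℝ) / v + 1) := Real.rpow_pos_of_pos (by linarith) _
  unfold gLY
  positivity

/-- **`Λ(x) = log g(x) + x log f(x)`** (`= log h(x)`, the printed `h = f^x g`) for `x > 0`.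
[cite: LaiYu2020, §4 proof of Lemma 4.1 ("h(x) = f(x)^x g(x)")] -/
theorem Lam_eq {u v : ℕ} (hu : 1 ≤ u) (hv : 1 ≤ v) (s : ℕ) (B : ℝ) {x : ℝ} (hx : 0 < x) :
    Lam u v s B x = Real.log (gLY u v s B x) +
      x * Real.log (fLY u v s (zeroSet_finite B).toFinset.card x) := by
  rw [log_gLY hu hv s B hx.le, log_fLY hv s _ hx]
  unfold Lam F phiLY
  ring

/-- `Λ(x₀) = log g(x₀)` at the root ("with maximal value `h(x₀) = g(x₀)`").
[cite: LaiYu2020, §4 proof of Lemma 4.1 ("h(x₀) = g(x₀)")] -/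
theorem Lam_root {u v : ℕ} (hu : 1 ≤ u) (hv : 1 ≤ v) (s : ℕ) (B : ℝ) {x₀ : ℝ} (hx₀ : 0 < x₀)
    (hroot : fLY u v s (zeroSet_finite B).toFinset.card x₀ = 1) :
    Lam u v s B x₀ = Real.log (gLY u v s B x₀) := by
  rw [Lam_eq hu hv s B hx₀, hroot, Real.log_one, mul_zero, add_zero]

/-- **`Λ'(x) = log f(x)`** for `x > 0` (the printed `h'(x)/h(x) = log f(x)`).
[cite: LaiYu2020, §4 proof of Lemma 4.1 ("a direct computation shows that h'(x)/h(x) = log f(x)")] -/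
theorem hasDerivAt_Lam {u v : ℕ} (hv : 1 ≤ v) (s : ℕ) (B : ℝ) {x : ℝ} (hx : 0 < x) :
    HasDerivAt (Lam u v s B) (Real.log (fLY u v s (zeroSet_finite B).toFinset.card x)) x := by
  have hρ := rho_pos (u := u) hv
  have hr : (0 : ℝ) ≤ (u : ℝ) / v := by positivity
  have h1 : HasDerivAt (fun y : ℝ => F (y + (2 * (u : ℝ) + v) / v)) (Real.log (x + (2 * (u : ℝ) + v) / v)) x := by
    have := (hasDerivAt_F (t := x + (2 * (u : ℝ) + v) / v) (by positivity)).comp x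
      ((hasDerivAt_id x).add_const _)
    simpa [Function.comp_def] using this
  have h2 : HasDerivAt (fun y : ℝ => F y) (Real.log x) x := hasDerivAt_F hx.ne'
  have h3 : HasDerivAt (fun y : ℝ => F (y + (u : ℝ) / v + 1)) (Real.log (x + (u : ℝ) / v + 1)) x := by
    have := (hasDerivAt_F (t := x + (u : ℝ) / v + 1) (by positivity)).comp x
      (((hasDerivAt_id x).add_const ((u : ℝ) / v)).add_const 1)
    simpa [Function.comp_def] using this
  have h4 : HasDerivAt (fun y : ℝ => F (y + (u : ℝ) / v)) (Real.log (x + (u : ℝ) / v)) x := by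
    have := (hasDerivAt_F (t := x + (u : ℝ) / v) (by positivity)).comp x ((hasDerivAt_id x).add_const _)
    simpa [Function.comp_def] using this
  have h := (((h1.sub h2).const_mul ((zeroSet_finite B).toFinset.card : ℝ)).sub
    ((h3.sub h4).const_mul ((s : ℝ) + 1))).const_add
    (Real.log (A₁ ((u : ℚ) / v) B) + Real.log (A₂ ((u : ℚ) / v) B) - ((s : ℝ) + 1) +
      (2 * (u : ℝ) + v) / v * ((zeroSet_finite B).toFinset.card : ℝ) * (1 + Real.log v))
  have e : Lam u v s B = fun y => Real.log (A₁ ((u : ℚ) / v) B) + Real.log (A₂ ((u : ℚ) / v) B) - ((s : ℝ) + 1) +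
      (2 * (u : ℝ) + v) / v * ((zeroSet_finite B).toFinset.card : ℝ) * (1 + Real.log v) +
      (((zeroSet_finite B).toFinset.card : ℝ) * (F (y + (2 * (u : ℝ) + v) / v) - F y) -
        ((s : ℝ) + 1) * (F (y + (u : ℝ) / v + 1) - F (y + (u : ℝ) / v))) := by
    funext y; unfold Lam; ring
  rw [e]
  refine h.congr_deriv ?_
  rw [log_fLY hv s _ hx]
  unfold phiLY
  ring

/-- `Λ` is continuous. [cite: LaiYu2020, §4 proof of Lemma 4.1 (h)] -/
theorem continuous_Lam (u v s : ℕ) (B : ℝ) : Continuous (Lam u v s B) := by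
  have h1 : Continuous fun x : ℝ => F (x + (2 * (u : ℝ) + v) / v) := continuous_F.comp (by fun_prop)
  have h2 : Continuous fun x : ℝ => F x := continuous_F
  have h3 : Continuous fun x : ℝ => F (x + (u : ℝ) / v + 1) := continuous_F.comp (by fun_prop)
  have h4 : Continuous fun x : ℝ => F (x + (u : ℝ) / v) := continuous_F.comp (by fun_prop)
  unfold Lam
  fun_prop

/-- **`Λ` is strictly increasing on `[0, x₀]`** (there `f > 1`).
[cite: LaiYu2020, §4 proof of Lemma 4.1 ("h(x) achieves its maximum only at x = x₀")] -/
theorem Lam_strictMonoOn {u v s : ℕ} {B : ℝ} (hv : 1 ≤ v) {x₀ : ℝ}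
    (hlt : ∀ x, 0 < x → x < x₀ → 1 < fLY u v s (zeroSet_finite B).toFinset.card x) :
    StrictMonoOn (Lam u v s B) (Icc 0 x₀) := by
  refine strictMonoOn_of_deriv_pos (convex_Icc 0 x₀) (continuous_Lam u v s B).continuousOn fun x hx => ?_
  rw [interior_Icc] at hx
  rw [(hasDerivAt_Lam hv s B hx.1).deriv]
  exact Real.log_pos (hlt x hx.1 hx.2)

/-- **`Λ` is strictly decreasing on `[x₀, ∞)`** (there `f < 1`).
[cite: LaiYu2020, §4 proof of Lemma 4.1 ("h(x) achieves its maximum only at x = x₀")] -/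
theorem Lam_strictAntiOn {u v s : ℕ} {B : ℝ} (hv : 1 ≤ v) {x₀ : ℝ} (hx₀ : 0 < x₀)
    (hgt : ∀ x, x₀ < x → fLY u v s (zeroSet_finite B).toFinset.card x < 1) :
    StrictAntiOn (Lam u v s B) (Ici x₀) := by
  refine strictAntiOn_of_deriv_neg (convex_Ici x₀) (continuous_Lam u v s B).continuousOn fun x hx => ?_
  rw [interior_Ici] at hx
  have hx' : 0 < x := hx₀.trans hx
  rw [(hasDerivAt_Lam hv s B hx').deriv]
  exact Real.log_neg (fLY_pos hv s _ hx') (hgt x hx)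

/-- `Λ(x) ≤ Λ(x₀)` for every `x ≥ 0` ("maximal value `h(x₀)`").
[cite: LaiYu2020, §4 proof of Lemma 4.1, eq. (4.8) ("R̂_n(k+θ) ≤ n^{O(1)} g(x₀)ⁿ")] -/
theorem Lam_le_root {u v s : ℕ} {B : ℝ} (hv : 1 ≤ v) {x₀ : ℝ} (hx₀ : 0 < x₀)
    (hlt : ∀ x, 0 < x → x < x₀ → 1 < fLY u v s (zeroSet_finite B).toFinset.card x)
    (hgt : ∀ x, x₀ < x → fLY u v s (zeroSet_finite B).toFinset.card x < 1)
    {x : ℝ} (hx : 0 ≤ x) : Lam u v s B x ≤ Lam u v s B x₀ := by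
  rcases le_or_gt x x₀ with h | h
  · exact (Lam_strictMonoOn hv hlt).monotoneOn ⟨hx, h⟩ ⟨hx₀.le, le_rfl⟩ h
  · exact (Lam_strictAntiOn hv hx₀ hgt).antitoneOn (self_mem_Ici) (mem_Ici.2 h.le) h.le

/-- **Strict gap away from `x₀`**: for `0 < δ ≤ x₀` there is `η ∈ (0,1]` with `Λ(x) ≤ Λ(x₀) − η` whenever
`x ≥ 0` and `|x − x₀| ≥ δ` (the printed "`r_{n,θ} ≤ n^{O(1)} max(h(x₀−ε₀), h(x₀+ε₀))ⁿ + …`", eq. (4.11)).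
[cite: LaiYu2020, §4 proof of Lemma 4.1, eq. (4.11)] -/
theorem Lam_gap {u v s : ℕ} {B : ℝ} (hv : 1 ≤ v) {x₀ : ℝ} (hx₀ : 0 < x₀)
    (hlt : ∀ x, 0 < x → x < x₀ → 1 < fLY u v s (zeroSet_finite B).toFinset.card x)
    (hgt : ∀ x, x₀ < x → fLY u v s (zeroSet_finite B).toFinset.card x < 1)
    {δ : ℝ} (hδ : 0 < δ) (hδx : δ ≤ x₀) :
    ∃ η : ℝ, 0 < η ∧ η ≤ 1 ∧ ∀ x : ℝ, 0 ≤ x → δ ≤ |x - x₀| → Lam u v s B x ≤ Lam u v s B x₀ - η := by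
  have hM := Lam_strictMonoOn hv hlt
  have hA := Lam_strictAntiOn hv hx₀ hgt
  have h1 : Lam u v s B (x₀ - δ) < Lam u v s B x₀ := hM ⟨by linarith, by linarith⟩ ⟨hx₀.le, le_rfl⟩ (by linarith)
  have h2 : Lam u v s B (x₀ + δ) < Lam u v s B x₀ := hA self_mem_Ici (mem_Ici.2 (by linarith)) (by linarith)
  refine ⟨min 1 (min (Lam u v s B x₀ - Lam u v s B (x₀ - δ)) (Lam u v s B x₀ - Lam u v s B (x₀ + δ))),
    lt_min one_pos (lt_min (by linarith) (by linarith)), min_le_left _ _, fun x hx hdist => ?_⟩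
  rcases le_or_gt x x₀ with h | h
  · rw [abs_of_nonpos (by linarith)] at hdist
    have : Lam u v s B x ≤ Lam u v s B (x₀ - δ) := hM.monotoneOn ⟨hx, h⟩ ⟨by linarith, by linarith⟩ (by linarith)
    have hm := (min_le_right (1 : ℝ) _).trans (min_le_left (Lam u v s B x₀ - Lam u v s B (x₀ - δ))
      (Lam u v s B x₀ - Lam u v s B (x₀ + δ)))
    linarith
  · rw [abs_of_pos (by linarith)] at hdist
    have : Lam u v s B x ≤ Lam u v s B (x₀ + δ) :=
      hA.antitoneOn (mem_Ici.2 (by linarith)) (mem_Ici.2 (by linarith)) (by linarith)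
    have hm := (min_le_right (1 : ℝ) _).trans (min_le_right (Lam u v s B x₀ - Lam u v s B (x₀ - δ))
      (Lam u v s B x₀ - Lam u v s B (x₀ + δ)))
    linarith

end Lemma41

end Literature.NumberTheory.Irrationality.LaiYu2020
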